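import Summits.CriticalPhenomena.PercolationContinuityZ3.Theorems.PercNearOneGluingNoHeavyLowerTailSahiE3LroOverBase
import Summits.CriticalPhenomena.PercolationContinuityZ3.Theorems.PercNearOneGluingNoHeavyLowerTailSahiE3DnfTwoSlot
import Mathlib.Logic.Equiv.Prod
import HarnessLib
import HarnessLib.Audit

/-!
# `NoHeavyLowerTail` (crux stmt-CriticalPhenomena-4575), Sahi programme P4: KAHN'S CONJECTURE 5 FOR EVERY LINEAR READ-ONCE FORMULA
# OVER AN OR OF TWO DISJOINT CONJUNCTIONS — `x₀ ∘₀ (x₁ ∘₁ (⋯ ∘ₙ₋₁ ((y₁∧…∧y_a) ∨ (z₁∧…∧z_b))))`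

Support file (cell `prim-l12`, seat P4, generation 12; `--supports stmt-CriticalPhenomena-4575`).  No named facts, no sorries;
standard axioms; def-free.

`cert_lro_over_dnf_two`: the certificate of `…SahiE3LroOverBase.cert_lro_over` over the base `…SahiE3DnfTwoSlot.cert_dnf_two_cube`,
transported to the pattern cube `Fin n ⊕ (Fin (a+1) ⊕ Fin (b+1)) → Bool` (strictly positive product weight on the base block, nonnegative
layer weights).  `latticeE3_nonneg_of_lro_over_dnf_two`: Sahi's `C₃` on every finite distributive lattice (LSM `μ ≥ 0`, join-primes,
product pattern marginal) for the slot `{x | x₀ ∘₀ (⋯ ∘ₙ₋₁ ((∀ k, j(inr (inl k)) ≤ x) ∨ (∀ k, j(inr (inr k)) ≤ x)))}`;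
`latticeE3_nonneg_lro_over_dnf_two_prod`: the Boolean form on `2^κ` (`θ > 0` on the base coordinates, `θ ≥ 0` elsewhere is not
needed: we assume `θ > 0` throughout for simplicity).  Examples: `w ∧ ((x₁∧x₂) ∨ (y₁∧y₂))`, `v ∨ (w ∧ ((x₁∧x₂) ∨ (y₁∧y₂∧y₃)))`.
-/

namespace Summit.CriticalPhenomena.PercolationContinuityZ3.Theorems.SahiE3LroOverDnf

open Finset SahiE3LroTransport
open scoped BigOperators

/-- **Certificate of a linear read-once formula over `(y₁∧…∧y_a) ∨ (z₁∧…∧z_b)` on the pattern cube**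
`Fin n ⊕ (Fin (a+1) ⊕ Fin (b+1)) → Bool`, product weight with nonnegative layer factors and strictly positive base factors. [this work] -/
theorem cert_lro_over_dnf_two (n a b : ℕ) (ops : Fin n → Bool)
    (w : Fin n ⊕ (Fin (a + 1) ⊕ Fin (b + 1)) → Bool → ℝ) (hw : ∀ i c, 0 ≤ w i c) (hw' : ∀ i c, 0 < w (Sum.inr i) c)
    (ν : (Fin n ⊕ (Fin (a + 1) ⊕ Fin (b + 1)) → Bool) → ℝ) (hν : ∀ t, ν t = ∏ i, w i (t i))
    (U : Finset (Fin n ⊕ (Fin (a + 1) ⊕ Fin (b + 1)) → Bool))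
    (hU : ∀ t, t ∈ U ↔ Fin.foldr n (fun i c => bif ops i then (t (Sum.inl i) || c) else (t (Sum.inl i) && c))
      (decide ((∀ k, t (Sum.inr (Sum.inl k)) = true) ∨ (∀ k, t (Sum.inr (Sum.inr k)) = true))) = true) :
    IsUpperSet (U : Set (Fin n ⊕ (Fin (a + 1) ⊕ Fin (b + 1)) → Bool)) ∧
    ∃ (R : (Fin n ⊕ (Fin (a + 1) ⊕ Fin (b + 1)) → Bool) → ℝ)
      (Fl : (Fin n ⊕ (Fin (a + 1) ⊕ Fin (b + 1)) → Bool) → (Fin n ⊕ (Fin (a + 1) ⊕ Fin (b + 1)) → Bool) → ℝ),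
      (∀ t ∈ U, 0 ≤ R t) ∧ (∀ t s, 0 ≤ Fl t s) ∧ (∀ t s, Fl t s ≠ 0 → s ≤ t) ∧
      (∀ t ∈ U, R t + ∑ s ∈ Uᶜ, Fl t s ≤ (∑ r, ν r) * ((∑ r, ν r) + ∑ r ∈ Uᶜ, ν r) * ν t) ∧
      (∀ s ∈ Uᶜ, ∑ t ∈ U, Fl t s = (∑ r, ν r) * (∑ r ∈ U, ν r) * ν s) ∧
      (∀ S S' : Finset (Fin n ⊕ (Fin (a + 1) ⊕ Fin (b + 1)) → Bool),
        IsUpperSet (S : Set (Fin n ⊕ (Fin (a + 1) ⊕ Fin (b + 1)) → Bool)) →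
        IsUpperSet (S' : Set (Fin n ⊕ (Fin (a + 1) ⊕ Fin (b + 1)) → Bool)) →
        (∑ r, ν r) * ((∑ t ∈ S, ν t) * (∑ t ∈ S' ∩ U, ν t) + (∑ t ∈ S', ν t) * (∑ t ∈ S ∩ U, ν t))
            - (∑ r ∈ U, ν r) * (∑ t ∈ S, ν t) * (∑ t ∈ S', ν t) ≤ ∑ t ∈ (S ∩ S') ∩ U, R t) := by
  -- the base: the DNF₂ cube pattern with its certificate
  obtain ⟨νQ, hνQ⟩ : ∃ f : (Fin (a + 1) ⊕ Fin (b + 1) → Bool) → ℝ, ∀ q, f q = ∏ i, w (Sum.inr i) (q i) := ⟨_, fun _ => rfl⟩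
  obtain ⟨G, hG⟩ : ∃ V : Finset (Fin (a + 1) ⊕ Fin (b + 1) → Bool), ∀ q, q ∈ V ↔ ((∀ k, q (Sum.inl k) = true) ∨ (∀ k, q (Sum.inr k) = true)) :=
    ⟨univ.filter fun q => (∀ k, q (Sum.inl k) = true) ∨ (∀ k, q (Sum.inr k) = true), fun q => by simp⟩
  obtain ⟨hGup, RQ, FlQ, g1, g2, g3, g4, g5, g6⟩ :=
    SahiE3DnfTwoSlot.cert_dnf_two_cube a b (fun i => w (Sum.inr i)) (fun i c => hw' i c) νQ hνQ G hG
  have hνQ0 : ∀ q, 0 ≤ νQ q := fun q => by rw [hνQ]; exact Finset.prod_nonneg fun i _ => hw _ _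
  have hHQ : ∀ S S' : Finset (Fin (a + 1) ⊕ Fin (b + 1) → Bool), IsUpperSet (S : Set (Fin (a + 1) ⊕ Fin (b + 1) → Bool)) → IsUpperSet (S' : Set (Fin (a + 1) ⊕ Fin (b + 1) → Bool)) →
      (∑ t ∈ S, νQ t) * (∑ t ∈ S', νQ t) ≤ (∑ t, νQ t) * ∑ t ∈ S ∩ S', νQ t := by
    -- Harris for the product weight on the base cube: from `cert_lro` on `Fin (a+b+2) → Bool`, re-indexed
    have hab : a + 1 + (b + 1) = a + b + 1 + 1 := by ring
    let E : Fin (a + b + 1 + 1) ≃ (Fin (a + 1) ⊕ Fin (b + 1)) := (finCongr hab).symm.trans finSumFinEquiv.symm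
    let eo : (Fin (a + b + 1 + 1) → Bool) ≃o (Fin (a + 1) ⊕ Fin (b + 1) → Bool) :=
      { toEquiv := Equiv.arrowCongr E (Equiv.refl Bool)
        map_rel_iff' := by
          intro f g
          constructor
          · intro h i
            simpa [Equiv.arrowCongr] using h (E i)
          · intro h j
            simpa [Equiv.arrowCongr] using h (E.symm j) }
    obtain ⟨UA, hUA⟩ : ∃ V : Finset (Fin (a + b + 1 + 1) → Bool), ∀ x, x ∈ V ↔ Fin.foldr (a + b + 1)
        (fun i c => bif (fun _ => true) i then (x i.castSucc || c) else (x i.castSucc && c)) (x (Fin.last (a + b + 1))) = true :=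
      ⟨univ.filter fun x => Fin.foldr (a + b + 1) (fun i c => bif (fun _ => true) i then (x i.castSucc || c) else (x i.castSucc && c))
        (x (Fin.last (a + b + 1))) = true, fun x => by simp⟩
    have hH0 := (SahiE3LroSlot.cert_lro (a + b + 1) (fun _ => true) (fun i => w (Sum.inr (E i)))
      (fun i c => hw _ _) (fun x => ∏ i, w (Sum.inr (E i)) (x i)) (fun _ => rfl) UA hUA).2.1
    refine harris_transport eo νQ (fun y => ?_) hH0
    rw [hνQ]
    exact (Fintype.prod_equiv E (fun i => w (Sum.inr (E i)) ((eo.symm y) i)) (fun j => w (Sum.inr j) (y j))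
      (fun i => by simp [eo, Equiv.arrowCongr])).symm
  -- linear read-once steps over the base
  obtain ⟨hUp, hHprod, R, Fl, c1, c2, c3, c4, c5, c6⟩ := SahiE3LroOverBase.cert_lro_over hνQ0 hHQ G hGup RQ FlQ g1 g2 g3 g4 g5 g6
    n ops (fun i => w (Sum.inl i)) (fun i c => hw _ _) (fun x => (∏ i, w (Sum.inl i) (x.1 i)) * νQ x.2) (fun _ => rfl)
    (univ.filter fun x => Fin.foldr n (fun i c => bif ops i then (x.1 i || c) else (x.1 i && c)) (decide (x.2 ∈ G)) = true)
    (fun x => by simp)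
  -- transport along `(Fin n → Bool) × (Fin (a + 1) ⊕ Fin (b + 1) → Bool) ≃o (Fin n ⊕ (Fin (a+1) ⊕ Fin (b+1)) → Bool)`
  let e : ((Fin n → Bool) × (Fin (a + 1) ⊕ Fin (b + 1) → Bool)) ≃o (Fin n ⊕ (Fin (a + 1) ⊕ Fin (b + 1)) → Bool) :=
    { toEquiv := (Equiv.sumArrowEquivProdArrow (Fin n) (Fin (a + 1) ⊕ Fin (b + 1)) Bool).symm
      map_rel_iff' := by
        rintro ⟨p1, p2⟩ ⟨q1, q2⟩
        simp only [Equiv.sumArrowEquivProdArrow, Equiv.coe_fn_symm_mk, Pi.le_def, Prod.mk_le_mk, Sum.forall,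
          Sum.elim_inl, Sum.elim_inr] }
  have hes : ∀ y : Fin n ⊕ (Fin (a + 1) ⊕ Fin (b + 1)) → Bool,
      e.symm y = (fun k => y (Sum.inl k), fun k => y (Sum.inr k)) := fun y => rfl
  have hνe : ∀ y, ν y = (fun x : (Fin n → Bool) × (Fin (a + 1) ⊕ Fin (b + 1) → Bool) => (∏ i, w (Sum.inl i) (x.1 i)) * νQ x.2) (e.symm y) := by
    intro y
    rw [hes, hν, Fintype.prod_sum_type]
    simp only [hνQ]
  have hUe : ∀ y, y ∈ U ↔ e.symm y ∈ (univ.filter fun x : (Fin n → Bool) × (Fin (a + 1) ⊕ Fin (b + 1) → Bool) =>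
      Fin.foldr n (fun i c => bif ops i then (x.1 i || c) else (x.1 i && c)) (decide (x.2 ∈ G)) = true) := by
    intro y
    rw [hes, hU, Finset.mem_filter]
    simp only [Finset.mem_univ, true_and, hG]
  obtain ⟨R', Fl', d1, d2, d3, d4, d5, d6⟩ := cert_transport e c1 c2 c3 c4 c5 c6 ν hνe U hUe
  refine ⟨?_, R', Fl', d1, d2, d3, d4, d5, d6⟩
  intro x y hxy hx
  simp only [Finset.mem_coe] at hx ⊢
  rw [hUe] at hx ⊢
  exact hUp (e.symm.monotone hxy) hx

end Summit.CriticalPhenomena.PercolationContinuityZ3.Theorems.SahiE3LroOverDnf
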